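import Literature.NumberTheory.Sieve.MatomakiRadziwillTheorem3VK
import Literature.NumberTheory.LFunctions.ExpSumBoundReduction
import HarnessLib

/-!
# Matomäki–Radziwiłł 2016, Theorems 1 and 3, from Vinogradov's exponential-sum estimate alone

Topic `Literature/NumberTheory/Sieve`.  Everything in this file is PROVED; no definition, no named
fact.

K. Matomäki, M. Radziwiłł, *Multiplicative functions in short intervals*, Ann. of Math. (2) 183
(2016), Theorem 1 (the named fact `MatomakiRadziwill2016_theorem1` of `MatomakiRadziwill.lean`) and
Theorem 3.  The tree proves the whole printed deduction (`MatomakiRadziwillTheorem3VK.lean`: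
`MatomakiRadziwill2016_theorem1_of_vk : 0 < c → HasVKZeroFreeRegion c T₀ → MatomakiRadziwill2016_theorem1`,
through Theorem 3, Lemmas 4, 11, 14, Proposition 1, Lemma 3 and the Granville–Soundararajan inputs,
all discharged), so that the only input left is a Vinogradov–Korobov zero-free region; and
`RichertBoundsFromExpSum.lean` / `ExpSumBoundReduction.lean` prove that region from Vinogradov's
estimate for the shifted zeta sums (`hasVKZeroFreeRegion_of_expSumBound`,
`hasVKZeroFreeRegion_of_vinogradovRange`).  This file records the composites, i.e. the exact
remaining trust base of Theorem 1 in the tree: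

* `MatomakiRadziwill2016_theorem3_of_expSumBound`, `MatomakiRadziwill2016_theorem1_of_expSumBound`,
  `matomaki_radziwill_of_expSumBound` — from `ExpSumBound C D` (Ford 2002, Theorem 2, with
  unspecified constants: `‖∑_{N<n≤R} (n+u)^{−it}‖ ≤ C N^{1 − log²N/(D log²t)}` for `1 ≤ N ≤ t`);
* `MatomakiRadziwill2016_theorem3_of_vinogradovRange`, `MatomakiRadziwill2016_theorem1_of_vinogradovRange`,
  `matomaki_radziwill_of_vinogradovRange` — from `VinogradovRangeBound K C c` (`K ≥ 1`, `C ≥ 0`,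
  `c > 0`): the same estimate only in Vinogradov's range `N^{K+1/2} ≤ t`, i.e. the standard
  consequence of Vinogradov's mean value theorem for `f(x) = −(t/2π) log(x + u)`
  (Titchmarsh (6.19.1); Ivić, Theorem 6.2; Ford 2002, Theorems 2–4 and §5).

So `MatomakiRadziwill2016_theorem1_holds` is exactly one classical theorem away: a proof of
`∃ K ≥ 1, ∃ C ≥ 0, ∃ c > 0, VinogradovRangeBound K C c` (Vinogradov–Korobov).

## References

* K. Matomäki, M. Radziwiłł, Ann. of Math. (2) 183 (2016), 1015–1056 (arXiv:1501.04585), Theorems 1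
  and 3; Lemma 2 and Lemma 11 are where "the zero-free region for the Riemann zeta-function" of
  Vinogradov–Korobov strength enters. [MatomakiRadziwillAnnals2016]
* K. Ford, *Vinogradov's integral and bounds for the Riemann zeta function*, Proc. London Math. Soc.
  (3) 85 (2002), 565–633, Theorem 2. [Ford2002]
* E. C. Titchmarsh, *The Theory of the Riemann Zeta-Function*, 2nd ed., §6.19 (6.19.1),
  Theorem 3.10. [Titchmarsh1986]
-/

namespace Literature.NumberTheory.Sieve

open Literature.NumberTheory.LFunctions

/-- **Matomäki–Radziwiłł 2016, Theorem 3, from Vinogradov's estimate in Ford's shape**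
(`ExpSumBound C D`, any `C ≥ 0`, `D > 0`). [cite: MatomakiRadziwillAnnals2016, Theorem 3]
[cite: Ford2002, Theorem 2] -/
theorem MatomakiRadziwill2016_theorem3_of_expSumBound {C D : ℝ} (h : ExpSumBound C D)
    (hC : 0 ≤ C) (hD : 0 < D) : MatomakiRadziwill2016_theorem3 := by
  obtain ⟨c, hc, hVK⟩ := hasVKZeroFreeRegion_of_expSumBound h hC hD
  exact MatomakiRadziwill2016_theorem3_of_vk hc hVK

/-- **Matomäki–Radziwiłł 2016, Theorem 1, from Vinogradov's estimate in Ford's shape**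
(`ExpSumBound C D`, any `C ≥ 0`, `D > 0`). [cite: MatomakiRadziwillAnnals2016, Theorem 1]
[cite: Ford2002, Theorem 2] -/
theorem MatomakiRadziwill2016_theorem1_of_expSumBound {C D : ℝ} (h : ExpSumBound C D)
    (hC : 0 ≤ C) (hD : 0 < D) : MatomakiRadziwill2016_theorem1 := by
  obtain ⟨c, hc, hVK⟩ := hasVKZeroFreeRegion_of_expSumBound h hC hD
  exact MatomakiRadziwill2016_theorem1_of_vk hc hVK

/-- **parity.S38 (`matomaki_radziwill`) from Vinogradov's estimate in Ford's shape.**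
[cite: MatomakiRadziwillAnnals2016, Theorem 1] [cite: Ford2002, Theorem 2] -/
theorem matomaki_radziwill_of_expSumBound {C D : ℝ} (h : ExpSumBound C D) (hC : 0 ≤ C)
    (hD : 0 < D) : matomaki_radziwill := by
  obtain ⟨c, hc, hVK⟩ := hasVKZeroFreeRegion_of_expSumBound h hC hD
  exact matomaki_radziwill_of_vk hc hVK

/-- **Matomäki–Radziwiłł 2016, Theorem 3, from Vinogradov's estimate in its natural range**
(`VinogradovRangeBound K C c`, `K ≥ 1`, `C ≥ 0`, `c > 0`; the range `λ < K + 1/2` is van der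
Corput's, `expSumBound_of_vinogradovRange`). [cite: MatomakiRadziwillAnnals2016, Theorem 3]
[cite: Titchmarsh1986, §6.19 (6.19.1)] -/
theorem MatomakiRadziwill2016_theorem3_of_vinogradovRange {K : ℕ} (hK : 1 ≤ K) {C c : ℝ}
    (hC : 0 ≤ C) (hc : 0 < c) (h : VinogradovRangeBound K C c) :
    MatomakiRadziwill2016_theorem3 := by
  obtain ⟨c', hc', hVK⟩ := hasVKZeroFreeRegion_of_vinogradovRange hK hC hc h
  exact MatomakiRadziwill2016_theorem3_of_vk hc' hVK

/-- **Matomäki–Radziwiłł 2016, Theorem 1, from Vinogradov's estimate in its natural range**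
(`VinogradovRangeBound K C c`, `K ≥ 1`, `C ≥ 0`, `c > 0`): the exact remaining input of
`MatomakiRadziwill2016_theorem1` in the tree. [cite: MatomakiRadziwillAnnals2016, Theorem 1]
[cite: Titchmarsh1986, §6.19 (6.19.1)] -/
theorem MatomakiRadziwill2016_theorem1_of_vinogradovRange {K : ℕ} (hK : 1 ≤ K) {C c : ℝ}
    (hC : 0 ≤ C) (hc : 0 < c) (h : VinogradovRangeBound K C c) :
    MatomakiRadziwill2016_theorem1 := by
  obtain ⟨c', hc', hVK⟩ := hasVKZeroFreeRegion_of_vinogradovRange hK hC hc h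
  exact MatomakiRadziwill2016_theorem1_of_vk hc' hVK

/-- **parity.S38 (`matomaki_radziwill`) from Vinogradov's estimate in its natural range.**
[cite: MatomakiRadziwillAnnals2016, Theorem 1] [cite: Titchmarsh1986, §6.19 (6.19.1)] -/
theorem matomaki_radziwill_of_vinogradovRange {K : ℕ} (hK : 1 ≤ K) {C c : ℝ} (hC : 0 ≤ C)
    (hc : 0 < c) (h : VinogradovRangeBound K C c) : matomaki_radziwill := by
  obtain ⟨c', hc', hVK⟩ := hasVKZeroFreeRegion_of_vinogradovRange hK hC hc h
  exact matomaki_radziwill_of_vk hc' hVK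

end Literature.NumberTheory.Sieve
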